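import Literature.Computability.Complexity.CodeFPBudgets
import Literature.Computability.Complexity.AOWListMatrix
import HarnessLib

/-!
# List matrices on codes: products, Gram matrices, traces and powers are polynomial time

Trunk T-CPLX-CORE (Literature/Computability/Complexity). Support file for the machine form of the
Allen–O'Donnell–Witmer refuter (running-time third of the discharge of `allen_odonnell_witmer_kSAT`,
`AOWRefutation.lean`): the list-matrix operations of `AOWListMatrix.lean`, with dimensions given in
UNARY and matrices coded as raw lists of raw lists of integers (`matE`), are computed on codes by
polynomial-time string functions (`CodeFP`, `CodeFP.lean` / `CodeFPArith.lean` / `CodeFPBudgets.lean`):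

* `entFP` (entry access), `sumRangeFP`, `tabFP` (tables of a map computed on codes);
* `mulLFP`, `gramLFP`, `traceLFP`, `oneLFP`;
* **`powLFP`** — `(1ᴺ, X, 1ᵗ) ↦ X^t` by the clocked loop of `t` products, whose accumulator is
  polynomially bounded on codes by the entry bounds of `AOWListMatrix.lean` (`entryBound_powL`)
  and the size lemmas (`length_matE_tab_le`).

## References

* S. Arora, B. Barak, *Computational Complexity: A Modern Approach*, CUP 2009, §1.3 (polynomial
  time is closed under composition and polynomially bounded loops).
* D. E. Knuth, *The Art of Computer Programming*, Vol. 2, 3rd ed., 1998, §4.6.3–4.6.4.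
-/

namespace Literature.Computability.Complexity

namespace LMat

open _root_.Computability Polynomial Brick CodeFP

/-- List matrices on codes: raw lists of raw lists of difference-pair integers. [folklore] -/
abbrev matE : List (List ℤ) → List Bool := rawE (rawE intE)

variable {σ : Type} {eσ : σ → List Bool}

/-! ### Entries, sums over ranges, tables -/

/-- **Entry access** `(X, i, j) ↦ ent X i j`. [cite: AroraBarak2009, §1.3] -/
theorem entFP : CodeFP (pairE matE (pairE natE natE)) intE (fun p => ent p.1 p.2.1 p.2.2) := by
  have hrow : CodeFP (pairE matE (pairE natE natE)) (rawE intE) (fun p => p.1.getD p.2.1 []) :=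
    ((rawGetD (rawE intE) (d := ([] : List ℤ)) rfl).comp ((fst _ _).pair (snd _ _).fst') :)
  have h := (rawGetOr intE).comp (hrow.pair ((snd _ _).snd'.pair (const (pairE matE (pairE natE natE)) (0 : ℤ))))
  exact h.congr fun p => rfl

/-- **Sums over a unary range** of a map computed on codes (context first). [cite: AroraBarak2009, §1.3] -/
theorem sumRangeFP {f : σ × ℕ → ℤ} (hf : CodeFP (pairE eσ natE) intE f) :
    CodeFP (pairE eσ unE) intE (fun p => sumRange p.2 fun l => f (p.1, l)) :=
  ((intSum.comp ((map hf).comp ((fst _ _).pair (urange.comp (snd _ _))))).congr fun p => by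
    simp [sumRange])

/-- **Tables** of a map computed on codes, dimensions in unary. [cite: AroraBarak2009, §1.3] -/
theorem tabFP {f : σ × (ℕ × ℕ) → ℤ} (hf : CodeFP (pairE eσ (pairE natE natE)) intE f) :
    CodeFP (pairE eσ (pairE unE unE)) matE (fun p => tab p.2.1 p.2.2 fun i j => f (p.1, (i, j))) := by
  -- inner row: context `(s, i)` over `range N₂`
  have hin : CodeFP (pairE (pairE eσ natE) (rawE natE)) (rawE intE)
      (fun q => q.2.map fun j => f (q.1.1, (q.1.2, j))) :=
    (map (hf.comp ((fst _ _).fst'.pair ((fst _ _).snd'.pair (snd _ _)))) :)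
  -- outer: context `(s, range N₂)` over `range N₁`
  have hout : CodeFP (pairE (pairE eσ (rawE natE)) (rawE natE)) matE
      (fun q => q.2.map fun i => q.1.2.map fun j => f (q.1.1, (i, j))) :=
    (map (hin.comp ((((fst _ _).fst'.pair (snd _ _))).pair (fst _ _).snd')) :)
  refine (hout.comp (((fst _ _).pair (urange.comp (snd _ _).snd')).pair (urange.comp (snd _ _).fst'))).congr
    fun p => ?_
  rfl

/-! ### Products, Gram matrices, traces, identity -/

/-- **`mulL` on codes**: `((1^{N₁}, 1^{N₂}, 1^{N₃}), X, Y) ↦ X Y`. [cite: KnuthTAOCP2, §4.6.4] -/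
theorem mulLFP : CodeFP (pairE (pairE unE (pairE unE unE)) (pairE matE matE)) matE
    (fun p => mulL p.1.1 p.1.2.1 p.1.2.2 p.2.1 p.2.2) := by
  -- the summand, context `((X, Y), (i, j))`, variable `l`
  let cE : (List (List ℤ) × List (List ℤ)) × (ℕ × ℕ) → List Bool := pairE (pairE matE matE) (pairE natE natE)
  have hX : CodeFP (pairE cE natE) intE (fun p => ent p.1.1.1 p.1.2.1 p.2) :=
    (entFP.comp ((fst _ _).fst'.fst'.pair ((fst _ _).snd'.fst'.pair (snd _ _))) :)
  have hY : CodeFP (pairE cE natE) intE (fun p => ent p.1.1.2 p.2 p.1.2.2) :=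
    (entFP.comp ((fst _ _).fst'.snd'.pair ((snd _ _).pair (fst _ _).snd'.snd')) :)
  have hprod : CodeFP (pairE cE natE) intE (fun p => ent p.1.1.1 p.1.2.1 p.2 * ent p.1.1.2 p.2 p.1.2.2) :=
    (intMul.comp (hX.pair hY) :)
  have hsum := sumRangeFP hprod
  -- the table, context `(N₂, (X, Y))`
  let sE : ℕ × (List (List ℤ) × List (List ℤ)) → List Bool := pairE unE (pairE matE matE)
  have hf := hsum.comp (((fst sE (pairE natE natE)).snd'.pair (snd _ _)).pair (fst _ _).fst')
  have htab := tabFP hf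
  refine (htab.comp (((fst _ _).snd'.fst'.pair (snd _ _)).pair ((fst _ _).fst'.pair (fst _ _).snd'.snd'))).congr
    fun p => ?_
  rfl

/-- **`gramL` on codes**: `((1^{N₁}, 1^{N₂}), B) ↦ BᵀB`. [cite: KnuthTAOCP2, §4.6.4] -/
theorem gramLFP : CodeFP (pairE (pairE unE unE) matE) matE (fun p => gramL p.1.1 p.1.2 p.2) := by
  let cE : List (List ℤ) × (ℕ × ℕ) → List Bool := pairE matE (pairE natE natE)
  have h1 : CodeFP (pairE cE natE) intE (fun p => ent p.1.1 p.2 p.1.2.1) :=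
    (entFP.comp ((fst _ _).fst'.pair ((snd _ _).pair (fst _ _).snd'.fst')) :)
  have h2 : CodeFP (pairE cE natE) intE (fun p => ent p.1.1 p.2 p.1.2.2) :=
    (entFP.comp ((fst _ _).fst'.pair ((snd _ _).pair (fst _ _).snd'.snd')) :)
  have hprod : CodeFP (pairE cE natE) intE (fun p => ent p.1.1 p.2 p.1.2.1 * ent p.1.1 p.2 p.1.2.2) :=
    (intMul.comp (h1.pair h2) :)
  have hsum := sumRangeFP hprod
  let sE : ℕ × List (List ℤ) → List Bool := pairE unE matE
  have hf := hsum.comp (((fst sE (pairE natE natE)).snd'.pair (snd _ _)).pair (fst _ _).fst')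
  have htab := tabFP hf
  refine (htab.comp (((fst _ _).fst'.pair (snd _ _)).pair ((fst _ _).snd'.pair (fst _ _).snd'))).congr
    fun p => ?_
  rfl

/-- **`traceL` on codes.** [folklore] -/
theorem traceLFP : CodeFP (pairE unE matE) intE (fun p => traceL p.1 p.2) := by
  have hd : CodeFP (pairE matE natE) intE (fun p => ent p.1 p.2 p.2) :=
    (entFP.comp ((fst _ _).pair ((snd _ _).pair (snd _ _))) :)
  exact ((sumRangeFP hd).comp ((snd _ _).pair (fst _ _))).congr fun p => rfl

/-- **The identity list matrix on codes.** [folklore] -/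
theorem oneLFP : CodeFP unE matE oneL := by
  have hf : CodeFP (pairE unitE (pairE natE natE)) intE (fun p => if p.2.1 = p.2.2 then (1 : ℤ) else 0) :=
    ((natEq.comp (snd _ _)).ite (const _ 1) (const _ 0)).congr fun p => by
      simp only [decide_eq_true_eq]
  exact ((tabFP hf).comp ((const unE ()).pair ((CodeFP.id unE).pair (CodeFP.id unE)))).congr fun N => rfl

/-! ### Sizes of list matrices on codes -/

/-- A raw code is bounded by the number of items and a bound on the item codes. [folklore] -/
theorem length_rawE_le_mul {α : Type} (e : α → List Bool) {l : List α} {E : ℕ}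
    (h : ∀ a ∈ l, (e a).length ≤ E) : (rawE e l).length ≤ l.length * (2 * E + 2) := by
  induction l with
  | nil => simp
  | cons a l ih =>
    rw [rawE_cons, length_boolPair, List.length_cons]
    have ha := h a (List.mem_cons_self ..)
    have hl := ih fun b hb => h b (List.mem_cons_of_mem _ hb)
    nlinarith

/-- **Code length of a table** with entries of size `≤ S`: at most `N₁ (2 N₂ (6S + 6) + 2)`. [folklore] -/
theorem length_matE_tab_le {N₁ N₂ : ℕ} {f : ℕ → ℕ → ℤ} {S : ℕ}
    (hS : ∀ i < N₁, ∀ j < N₂, Nat.size (f i j).natAbs ≤ S) :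
    (matE (tab N₁ N₂ f)).length ≤ N₁ * (2 * (N₂ * (6 * S + 6)) + 2) := by
  have hrow : ∀ r ∈ tab N₁ N₂ f, (rawE intE r).length ≤ N₂ * (6 * S + 6) := by
    intro r hr
    obtain ⟨hlen, hx⟩ := mem_tab hr
    have := length_rawE_le_mul intE (l := r) (E := 3 * S + 2) fun x hxr => by
      obtain ⟨i, hi, j, hj, rfl⟩ := hx x hxr
      exact (length_dpEnc_le _).trans (by have := hS i hi j hj; omega)
    rw [hlen] at this
    exact this.trans (le_of_eq (by ring))
  exact (length_rawE_le_mul (rawE intE) hrow).trans (by rw [length_tab])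

/-- Every entry of a coded matrix is below `2^{|code|}`. [folklore] -/
theorem entryBound_of_code (X : List (List ℤ)) : EntryBound X (2 ^ (matE X).length) := by
  intro i j
  unfold ent
  by_cases hi : i < X.length
  · rw [List.getD_eq_getElem _ _ hi]
    by_cases hj : j < (X[i]).length
    · rw [List.getD_eq_getElem _ _ hj]
      have hmem : X[i][j] ∈ X[i] := List.getElem_mem hj
      have hrow : X[i] ∈ X := List.getElem_mem hi
      have h1 := size_natAbs_le_length_intE (X[i][j])
      have h2 := length_item_le_length_rawE intE hmem
      have h3 := length_item_le_length_rawE (rawE intE) hrow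
      have hlt := Nat.lt_size_self (X[i][j]).natAbs
      have h4 : (matE X).length = (rawE (rawE intE) X).length := rfl
      exact (hlt.trans_le (Nat.pow_le_pow_right (by norm_num) (by omega))).le
    · rw [List.getD_eq_default _ _ (not_lt.1 hj)]; simp
  · rw [List.getD_eq_default _ _ (not_lt.1 hi)]; simp

/-! ### Powers by the clocked product loop -/

/-- `powL` is always a table. [folklore] -/
theorem powL_eq_tab (N : ℕ) (X : List (List ℤ)) : ∀ t : ℕ, ∃ f, powL N X t = tab N N f
  | 0 => ⟨_, rfl⟩
  | _ + 1 => ⟨_, rfl⟩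

/-- **Matrix powers on codes**: `(1ᴺ, X, 1ᵗ) ↦ X^t` by `t` clocked products; the accumulator stays
polynomially bounded (entries of `X^t` are below `(N · 2^{|X|})^t`). [cite: AroraBarak2009, §1.3;
KnuthTAOCP2, §4.6.3] -/
theorem powLFP : CodeFP (pairE unE (pairE matE unE)) matE (fun p => powL p.1 p.2.1 p.2.2) := by
  -- the step, context `(N, X)`, budget item `()`, accumulator `acc ↦ acc X`
  let sE : ℕ × List (List ℤ) → List Bool := pairE unE matE
  have hstep : CodeFP (pairE sE (pairE unitE matE)) matE (fun t => mulL t.1.1 t.1.1 t.1.1 t.2.2 t.1.2) :=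
    (mulLFP.comp ((((fst _ _).fst'.pair ((fst _ _).fst'.pair (fst _ _).fst'))).pair
      ((snd _ _).snd'.pair (fst _ _).snd')) :)
  have hinit : CodeFP sE matE (fun s => oneL s.1) := (oneLFP.comp (fst _ _) :)
  have h := foldl (step := fun (s : ℕ × List (List ℤ)) (_ : Unit) acc => mulL s.1 s.1 s.1 acc s.2)
    (init := fun s => oneL s.1) hstep hinit
    (X * (2 * (X * (6 * (2 * X * X + X + 1) + 6)) + 2)) (fun s l₁ l₂ => by
      obtain ⟨N, M⟩ := s
      have hfold : l₁.foldl (fun acc (_ : Unit) => mulL N N N acc M) (oneL N) = powL N M l₁.length := by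
        have := foldl_mulL N M l₁ 0
        simpa [powL] using this
      simp only [hfold, sE, pairE_apply, length_boolPair, eval_add, eval_mul, eval_X, eval_ofNat, eval_one]
      set L := 2 * (2 * (unE N).length + 2 + (matE M).length) + 2 + (rawE unitE (l₁ ++ l₂)).length with hL
      obtain ⟨f, hf⟩ := powL_eq_tab N M l₁.length
      -- entry bound of the power
      have hB := entryBound_powL (N := N) (entryBound_of_code M) l₁.length
      set β := 2 ^ (matE M).length
      set S := Nat.size (max 1 (N * β) ^ l₁.length)
      have hS : ∀ i < N, ∀ j < N, Nat.size (f i j).natAbs ≤ S := by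
        intro i hi j hj
        have h := hB i j
        rw [hf, ent_tab f hi hj] at h
        exact size_mono h
      have hlen := length_matE_tab_le hS
      rw [← hf] at hlen
      -- numerics: `N ≤ L`, `|l₁| ≤ L`, `S ≤ 2L² + L + 1`
      have hN : N ≤ L := by rw [hL, length_unE]; omega
      have hl₁ : l₁.length ≤ L := by
        have := length_le_length_rawE unitE (l₁ ++ l₂)
        simp only [List.length_append] at this
        omega
      have hSle : S ≤ 2 * L * L + L + 1 := by
        have h1 := size_pow_le (max 1 (N * β)) l₁.length
        have h2 : Nat.size (max 1 (N * β)) ≤ L + L := by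
          rcases le_total 1 (N * β) with h | h
          · rw [max_eq_right h]
            refine (size_mul_le N β).trans ?_
            have : Nat.size β = (matE M).length + 1 := by simp [β, Nat.size_pow]
            have hN' : Nat.size N ≤ N := by
              rw [Nat.size_le]; exact Nat.lt_two_pow_self
            rw [this]; omega
          · rw [max_eq_left h]; simp; omega
        calc S ≤ l₁.length * Nat.size (max 1 (N * β)) + 1 := h1
          _ ≤ L * (L + L) + 1 := by gcongr
          _ = 2 * L * L + 1 := by ring
          _ ≤ _ := by omega
      calc (matE (powL N M l₁.length)).length ≤ N * (2 * (N * (6 * S + 6)) + 2) := hlen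
        _ ≤ L * (2 * (L * (6 * (2 * L * L + L + 1) + 6)) + 2) := by gcongr)
  refine ((h.comp (((fst _ _).pair (snd _ _).fst').pair (replicateUnit.comp (snd _ _).snd'))).congr
    fun p => ?_)
  obtain ⟨N, M, t⟩ := p
  have := foldl_mulL N M (List.replicate t ()) 0
  simpa [powL] using this

end LMat

end Literature.Computability.Complexity
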